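import Mathlib
import Summits.NavierStokesRegularity.NavierStokesRegularity.Theorems.OrthantWakeOrthantHopWakeBondFlux
import HarnessLib

/-!
# `OrthantWake.OrthantHopWake` — support: the DISSIPATIVE CAP of the tail energy and the per-hop
ratchet below the viscous threshold (helper file for item stmt-NavierStokesRegularity-24639;
`--supports`)

The crux `OrthantHopWake` (item 24639) asks, for every shell `n` beyond a transient depth and
every time `t`, for the per-hop ratchet `T_{n+1}(t) ≤ (1+ε₀)^{-(1+η)} max_{u≤t} T_n(u)` of the
tail energies `T_n = Σ_{k≥n} Σ_i ½ X_{i,k}²` of a regular solution of the `ν`-viscous lattice,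
with constants chosen BEFORE `ν`. Any proof has two halves: an inertial-range half (the open
content: the wake of the cascade front, the lever `FluxCappedByResidue` of
`OrthantWakeOrthantHopWakeReduction`) and a dissipation-range half, where the bond flux into the
tail above `n` is beaten by the viscous damping of that tail. This file proves the second half,
uniformly in the table (only `|α_{·,(0,0,1)}| ≤ 1` and the cancellation law (4.3) are used; no
sign condition):

* (from `OrthantWakeOrthantHopWakeBondFlux`) `orthantHop_abs_botSum_le` — the bond flux through
  `n → n+1` is controlled by the shell energies it connects:
  `|Π_n| ≤ 8 (1+ε₀)^{5n/2} e_n (θ e_{n+1} + 2/θ)` for every `θ > 0`;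
* `orthantHop_tail_dissipativeCap` — THE DISSIPATIVE CAP: for `0 ≤ t₀ ≤ t ≤ s`, if
  `e_n ≤ E` on `[t₀,t]` then
  `T_{n+1}(t) ≤ T_{n+1}(t₀) e^{-ν(1+ε₀)^{2(n+1)}(t-t₀)} + 128 (1+ε₀)^{n-4} ν^{-2} E²`
  (the finite partial tails satisfy `E_L' ≤ Π_n + topSum(n+L) − 2ν(1+ε₀)^{2(n+1)} E_L`; absorb
  `Π_n` by the bound above with `θ` tuned to the damping rate; linear Grönwall with NEGATIVE rate
  (`Mathlib`'s `gronwallBound`); let `L → ∞`);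
* `orthantHop_ratchet_of_viscousThreshold` — consequently the crux's inequality holds at every
  `(n, t)` at which the running maximum `M` of `T_n` on `[0,t]` is below the VISCOUS THRESHOLD,
  `128 (1+ε₀)^{n-4} ν^{-2} M ≤ (1+ε₀)^{-(1+η)}`: then `T_{n+1}(t) ≤ (1+ε₀)^{-(1+η)} M`;
  `orthantHop_hop_of_viscousThreshold` restates this in the literal `∃ u ∈ [0,t]` form of the
  route decl.

HONEST FRAMING: elementary real analysis of Tao-type MODEL lattice ODEs (route OrthantWake, rung
TL-M2Break). The crux itself is NOT proved here: the threshold shell depends on `ν` (and on the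
size of the solution), whereas the crux fixes its transient depth before `ν`; closing that gap is
exactly the inertial-range half. Nothing in this file bears on Navier–Stokes regularity.
-/

noncomputable section

-- the sub-problem namespace `NavierStokesRegularity.NavierStokesRegularity` is the tree's layout (D-0017)
set_option linter.dupNamespace false

namespace Summit.NavierStokesRegularity.NavierStokesRegularity.Theorems

open Set Filter MeasureTheory intervalIntegral
open scoped Topology
open Literature.Analysis.FluidPDE.TaoCascade

/-! ## The dissipative cap of the tail energy -/

/-- **DISSIPATIVE CAP of the tail energy (dissipation-range half of the per-hop ratchet).** For a
cancelling table (Tao 2016 (4.3)) with inter-shell constants of modulus `≤ 1` and a regular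
solution of the `ν`-viscous lattice on `[0,s]` (continuous modes, (4.5) weight bound, exact motion
within `[0,s]`), the tail energy above shell `n`, `T_{n+1} = Σ_j Σ_i ½ X_{i,n+1+j}²`, obeys for
`0 ≤ t₀ ≤ t ≤ s`: if the shell energy `e_n = Σ_i ½ X_{i,n}²` is `≤ E` on `[t₀,t]` (`E > 0`), then
`T_{n+1}(t) ≤ T_{n+1}(t₀)·exp(−ν(1+ε₀)^{2(n+1)}(t−t₀)) + 128 (1+ε₀)^{n−4} ν^{−2} E²`.
Proof: the partial tails `E_L = Σ_{j<L} e_{n+1+j}` have derivative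
`Π_n + topSum(n+L) − Σ_j ν(1+ε₀)^{2(n+1+j)}·2e_{n+1+j} ≤ Π_n + δ_L − 2ν(1+ε₀)^{2(n+1)} E_L`
(telescoping `sum_range_sum_quadTerm_mul`, escaping flux `δ_L = O((1+ε₀)^{-20(n+L)})`); the
bond flux is absorbed by `orthantHop_abs_botSum_le` with `θ = ν(1+ε₀)^{2(n+1)}/(8(1+ε₀)^{5n/2}E)`,
leaving `E_L' ≤ −ν(1+ε₀)^{2(n+1)} E_L + 128(1+ε₀)^{5n}E²/(ν(1+ε₀)^{2(n+1)}) + δ_L`; linear Grönwall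
with negative rate (`gronwallBound`) and `L → ∞`. MODEL-lattice analysis; uniform in the table; no
sign condition. [this file] -/
theorem orthantHop_tail_dissipativeCap {ε₀ ν s M : ℝ} (hε : 0 < ε₀) (hν : 0 < ν)
    {α : Fin 4 → Fin 4 → Fin 4 → ℤ × ℤ × ℤ → ℝ} (hc : IsCancellingCoeff α)
    (hA : ∀ i₁ i₂ i₃ : Fin 4, |α i₁ i₂ i₃ (0, 0, 1)| ≤ 1)
    {X : Fin 4 → ℤ → ℝ → ℝ}
    (hM : ∀ (t : ℝ) (i : Fin 4) (k : ℤ), (1 + (1 + ε₀) ^ ((10 : ℝ) * k)) * |X i k t| ≤ M)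
    (hcont : ∀ (i : Fin 4) (k : ℤ), Continuous (X i k))
    (hder : ∀ (i : Fin 4) (k : ℤ), ∀ t ∈ Icc (0 : ℝ) s, HasDerivWithinAt (X i k)
      (quadTerm ε₀ α X i k t - ν * (1 + ε₀) ^ ((2 : ℝ) * k) * X i k t) (Icc (0 : ℝ) s) t)
    (n : ℕ) {t₀ t E : ℝ} (ht₀ : 0 ≤ t₀) (ht₀t : t₀ ≤ t) (hts : t ≤ s) (hEpos : 0 < E)
    (hEmax : ∀ u ∈ Icc t₀ t, ∑ i : Fin 4, (1 / 2 : ℝ) * X i (n : ℤ) u ^ 2 ≤ E) :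
    (∑' j : ℕ, ∑ i : Fin 4, (1 / 2 : ℝ) * X i ((n + 1 : ℕ) + (j : ℤ)) t ^ 2) ≤
      (∑' j : ℕ, ∑ i : Fin 4, (1 / 2 : ℝ) * X i ((n + 1 : ℕ) + (j : ℤ)) t₀ ^ 2) *
          Real.exp (-(ν * (1 + ε₀) ^ ((2 : ℝ) * (n + 1))) * (t - t₀)) +
        128 * (1 + ε₀) ^ ((n : ℝ) - 4) / ν ^ 2 * E ^ 2 := by
  have h0 : (0 : ℝ) < 1 + ε₀ := by linarith
  have h1 : (1 : ℝ) ≤ 1 + ε₀ := by linarith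
  have hM0 : 0 ≤ M :=
    le_trans (mul_nonneg (add_nonneg zero_le_one (Real.rpow_nonneg h0.le _)) (abs_nonneg _))
      (hM t 0 0)
  set q : ℝ := ((1 + ε₀) ^ (10 : ℝ))⁻¹ with hq
  have hq10 : 0 < (1 + ε₀) ^ (10 : ℝ) := Real.rpow_pos_of_pos h0 _
  have hq0 : 0 ≤ q := inv_nonneg.2 hq10.le
  have hq1 : q < 1 := inv_lt_one_of_one_lt₀ (Real.one_lt_rpow (by linarith) (by norm_num))
  -- the viscous coefficients, as a function of the shell
  set c : ℤ → ℝ := fun K => ν * (1 + ε₀) ^ ((2 : ℝ) * K) with hcdef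
  have hc0 : ∀ K : ℤ, 0 ≤ c K := fun K => mul_nonneg hν.le (Real.rpow_nonneg h0.le _)
  have hder' : ∀ (i : Fin 4) (K : ℤ), ∀ u ∈ Icc (0 : ℝ) s, HasDerivWithinAt (X i K)
      (quadTerm ε₀ α X i K u - c K * X i K u) (Icc (0 : ℝ) s) u := fun i K u hu => hder i K u hu
  -- the base shell of the tail and its damping rate
  set N : ℤ := ((n + 1 : ℕ) : ℤ) with hN
  have hNreal : ((N : ℤ) : ℝ) = (n : ℝ) + 1 := by simp only [hN]; push_cast; ring
  have hcN : 0 < c N := mul_pos hν (Real.rpow_pos_of_pos h0 _)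
  have hcmono : ∀ k : ℕ, c N ≤ c (N + (k : ℤ)) := by
    intro k
    simp only [hcdef]
    refine mul_le_mul_of_nonneg_left (Real.rpow_le_rpow_of_exponent_le h1 ?_) hν.le
    push_cast
    linarith [(Nat.cast_nonneg k : (0 : ℝ) ≤ k)]
  -- the flux prefactor `s = (1+ε₀)^{5n/2}` of the bond `n → n+1`
  set sc : ℝ := (1 + ε₀) ^ ((5 : ℝ) * ((n : ℕ) : ℤ) / 2) with hsc
  have hsc0 : 0 < sc := Real.rpow_pos_of_pos h0 _
  -- partial tails over the shells `N, …, N+L-1` and their derivatives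
  set EL : ℕ → ℝ → ℝ := fun L u =>
    ∑ k ∈ Finset.range L, ∑ i : Fin 4, (1 / 2 : ℝ) * X i (N + (k : ℤ)) u ^ 2 with hEL
  set D : ℕ → ℝ → ℝ := fun L u => ∑ k ∈ Finset.range L, ∑ i : Fin 4,
    X i (N + (k : ℤ)) u * (quadTerm ε₀ α X i (N + (k : ℤ)) u - c (N + (k : ℤ)) * X i (N + (k : ℤ)) u)
    with hD
  have hderE : ∀ (L : ℕ), ∀ u ∈ Icc (0 : ℝ) s, HasDerivWithinAt (EL L) (D L u) (Icc 0 s) u := by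
    intro L u hu
    simp only [hEL, hD]
    refine HasDerivWithinAt.fun_sum fun k _ => HasDerivWithinAt.fun_sum fun i _ => ?_
    have h := ((hder' i (N + (k : ℤ)) u hu).pow 2).const_mul (1 / 2 : ℝ)
    refine h.congr_deriv ?_
    rw [show (2 : ℕ) - 1 = 1 from rfl, pow_one]
    push_cast
    ring
  have hELcont : ∀ L : ℕ, Continuous (EL L) := by
    intro L
    simp only [hEL]
    fun_prop
  have hEL0 : ∀ (L : ℕ) (u : ℝ), 0 ≤ EL L u := fun L u =>
    Finset.sum_nonneg fun k _ => Finset.sum_nonneg fun i _ => by positivity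
  -- the escaping flux at the top of the partial tail
  set δ : ℕ → ℝ := fun L => coeffAbs α * M ^ 3 * (q ^ 2) ^ n * (q ^ 2) ^ L with hδ
  have hδ0 : ∀ L, 0 ≤ δ L := fun L =>
    mul_nonneg (mul_nonneg (mul_nonneg (coeffAbs_nonneg α) (pow_nonneg hM0 3))
      (pow_nonneg (sq_nonneg q) n)) (pow_nonneg (sq_nonneg q) L)
  -- the derivative of the partial tail: bond flux in, escaping flux out, MINUS the damping
  have hDle : ∀ (L : ℕ) (u : ℝ), D L u ≤ botSum ε₀ α X n u + δ L - 2 * c N * EL L u := by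
    intro L u
    have hsplit : D L u = (∑ k ∈ Finset.range L, ∑ i : Fin 4,
        quadTerm ε₀ α X i (N + k) u * X i (N + k) u) -
        ∑ k ∈ Finset.range L, ∑ i : Fin 4, c (N + (k : ℤ)) * X i (N + (k : ℤ)) u ^ 2 := by
      simp only [hD, ← Finset.sum_sub_distrib]
      refine Finset.sum_congr rfl fun k _ => Finset.sum_congr rfl fun i _ => by ring
    have hdiss : 2 * c N * EL L u ≤
        ∑ k ∈ Finset.range L, ∑ i : Fin 4, c (N + (k : ℤ)) * X i (N + (k : ℤ)) u ^ 2 := by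
      simp only [hEL, Finset.mul_sum]
      refine Finset.sum_le_sum fun k _ => Finset.sum_le_sum fun i _ => ?_
      have := hcmono k
      nlinarith [sq_nonneg (X i (N + (k : ℤ)) u)]
    have hstep1 : ∑ k ∈ Finset.range L, ∑ i : Fin 4,
        quadTerm ε₀ α X i (N + k) u * X i (N + k) u ≤ botSum ε₀ α X n u + δ L := by
      rw [sum_range_sum_quadTerm_mul ε₀ hc X N L u]
      have hN1 : N - 1 = (n : ℤ) := by simp only [hN]; push_cast; ring
      have hidx : N + (L : ℤ) - 1 = ((n + L : ℕ) : ℤ) := by simp only [hN]; push_cast; ring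
      rw [hN1, hidx]
      have hbot := botSum_eq_neg_topSum ε₀ hc X (n : ℤ) u
      have hXb : ∀ i : Fin 4, |X i ((n + L : ℕ) : ℤ) u| ≤ M * q ^ (n + L) ∧
          |X i (((n + L : ℕ) : ℤ) + 1) u| ≤ M * q ^ (n + L) :=
        fun i => ⟨orthantBreak_abs_le hε (by omega) (hM u i _),
          orthantBreak_abs_le hε (by omega) (hM u i _)⟩
      have htop := abs_topSum_le ε₀ h0 α X ((n + L : ℕ) : ℤ) u
        (mul_nonneg hM0 (pow_nonneg hq0 (n + L))) hXb
      have hgain : (1 + ε₀) ^ ((5 : ℝ) * (((n + L : ℕ) : ℤ) : ℝ) / 2) ≤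
          ((1 + ε₀) ^ (10 : ℝ)) ^ (n + L) := by
        rw [← Real.rpow_natCast, ← Real.rpow_mul h0.le]
        push_cast
        exact Real.rpow_le_rpow_of_exponent_le h1
          (by linarith [(Nat.cast_nonneg n : (0 : ℝ) ≤ n), (Nat.cast_nonneg L : (0 : ℝ) ≤ L)])
      have hcA := coeffAbs_nonneg α
      have hPL : ((1 + ε₀) ^ (10 : ℝ)) ^ (n + L) * q ^ (n + L) = 1 := by
        rw [← mul_pow, hq, mul_inv_cancel₀ hq10.ne', one_pow]
      have htop' : topSum ε₀ α X ((n + L : ℕ) : ℤ) u ≤ δ L :=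
        calc topSum ε₀ α X ((n + L : ℕ) : ℤ) u ≤ |topSum ε₀ α X ((n + L : ℕ) : ℤ) u| :=
              le_abs_self _
          _ ≤ (1 + ε₀) ^ ((5 : ℝ) * (((n + L : ℕ) : ℤ) : ℝ) / 2) * (M * q ^ (n + L)) ^ 3 *
                coeffAbs α := htop
          _ ≤ ((1 + ε₀) ^ (10 : ℝ)) ^ (n + L) * (M * q ^ (n + L)) ^ 3 * coeffAbs α :=
              mul_le_mul_of_nonneg_right
                (mul_le_mul_of_nonneg_right hgain
                  (pow_nonneg (mul_nonneg hM0 (pow_nonneg hq0 _)) 3))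
                hcA
          _ = coeffAbs α * M ^ 3 *
                ((((1 + ε₀) ^ (10 : ℝ)) ^ (n + L) * q ^ (n + L)) * (q ^ (n + L)) ^ 2) := by ring
          _ = δ L := by rw [hPL]; simp only [hδ]; ring
      linarith
    rw [hsplit]
    linarith
  -- absorb the bond flux: `Π_n ≤ c_N e_{n+1} + 128 sc² E²/c_N` on `[t₀,t]`
  set Γ : ℝ := 128 * sc ^ 2 * E ^ 2 / c N with hΓ
  have hΓ0 : 0 ≤ Γ := by positivity
  have hflux : ∀ u ∈ Icc t₀ t,
      botSum ε₀ α X n u ≤ c N * (∑ i : Fin 4, (1 / 2 : ℝ) * X i (N : ℤ) u ^ 2) + Γ := by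
    intro u hu
    set θ : ℝ := c N / (8 * sc * E) with hθ
    have hθpos : 0 < θ := by positivity
    have hb := orthantHop_abs_botSum_le h0 hA X ((n : ℕ) : ℤ) u hθpos
    have hEn := hEmax u hu
    have hE0 : 0 ≤ ∑ i : Fin 4, (1 / 2 : ℝ) * X i (n : ℤ) u ^ 2 :=
      Finset.sum_nonneg fun i _ => by positivity
    have hN' : ((n : ℕ) : ℤ) + 1 = N := by simp only [hN]; push_cast; ring
    rw [hN'] at hb
    set e1 : ℝ := ∑ i : Fin 4, (1 / 2 : ℝ) * X i N u ^ 2 with he1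
    have he10 : 0 ≤ e1 := Finset.sum_nonneg fun i _ => by positivity
    have hfac0 : 0 ≤ θ * e1 + 2 / θ := by positivity
    calc botSum ε₀ α X n u ≤ |botSum ε₀ α X n u| := le_abs_self _
      _ ≤ 8 * sc * (∑ i : Fin 4, (1 / 2 : ℝ) * X i (n : ℤ) u ^ 2) * (θ * e1 + 2 / θ) := hb
      _ ≤ 8 * sc * E * (θ * e1 + 2 / θ) :=
          mul_le_mul_of_nonneg_right (mul_le_mul_of_nonneg_left hEn (by positivity)) hfac0
      _ = c N * e1 + Γ := by
          simp only [hθ, hΓ]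
          field_simp
          ring
  -- hence the LINEAR differential inequality with negative rate for the partial tails
  have hDle2 : ∀ (L : ℕ), ∀ u ∈ Icc t₀ t, D L u ≤ -(c N) * EL L u + (Γ + δ L) := by
    intro L u hu
    rcases Nat.eq_zero_or_pos L with hL | hL
    · subst hL
      have hD0 : D 0 u = 0 := by simp [hD]
      have hE0 : EL 0 u = 0 := by simp [hEL]
      rw [hD0, hE0]
      nlinarith [hΓ0, hδ0 0]
    · have hfirst : (∑ i : Fin 4, (1 / 2 : ℝ) * X i (N : ℤ) u ^ 2) ≤ EL L u := by
        have hmem : (0 : ℕ) ∈ Finset.range L := Finset.mem_range.2 hL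
        have h := Finset.single_le_sum (f := fun k : ℕ =>
            ∑ i : Fin 4, (1 / 2 : ℝ) * X i (N + (k : ℤ)) u ^ 2)
          (fun k _ => Finset.sum_nonneg fun i _ => by positivity) hmem
        simpa [hEL] using h
      have h1 := hDle L u
      have h2 := hflux u hu
      nlinarith [hcN, hfirst, h1, h2]
  -- Grönwall on `[t₀, t]`
  have hEt : ∀ L : ℕ, EL L t ≤ EL L t₀ * Real.exp (-(c N) * (t - t₀)) + (Γ + δ L) / c N := by
    intro L
    have hcontOn : ContinuousOn (EL L) (Icc t₀ t) := (hELcont L).continuousOn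
    have hderiv : ∀ x ∈ Ico t₀ t, HasDerivWithinAt (EL L) (D L x) (Ici x) x := by
      intro x hx
      have hxs : x < s := lt_of_lt_of_le hx.2 hts
      have hx0 : 0 ≤ x := ht₀.trans hx.1
      have h := hderE L x ⟨hx0, hxs.le⟩
      refine h.mono_of_mem_nhdsWithin ?_
      exact mem_of_superset (Icc_mem_nhdsGE hxs) (Icc_subset_Icc hx0 le_rfl)
    have hf' : ∀ x ∈ Ico t₀ t, ∀ r, D L x < r →
        ∃ᶠ z in 𝓝[>] x, (z - x)⁻¹ * (EL L z - EL L x) < r := by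
      intro x hx r hr
      have h := (hderiv x hx).liminf_right_slope_le hr
      refine h.mono fun z hz => ?_
      rw [slope_def_field, div_eq_inv_mul] at hz
      exact hz
    have hbound : ∀ x ∈ Ico t₀ t, D L x ≤ -(c N) * EL L x + (Γ + δ L) :=
      fun x hx => hDle2 L x ⟨hx.1, hx.2.le⟩
    have hG := le_gronwallBound_of_liminf_deriv_right_le hcontOn hf' le_rfl hbound t
      ⟨ht₀t, le_rfl⟩
    rw [gronwallBound_of_K_ne_0 (neg_ne_zero.2 hcN.ne')] at hG
    have hexp0 : 0 < Real.exp (-(c N) * (t - t₀)) := Real.exp_pos _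
    have hexp1 : Real.exp (-(c N) * (t - t₀)) ≤ 1 := by
      apply Real.exp_le_one_iff.2
      nlinarith [hcN, ht₀t]
    have hsecond : (Γ + δ L) / -(c N) * (Real.exp (-(c N) * (t - t₀)) - 1) ≤ (Γ + δ L) / c N := by
      rw [div_neg, neg_mul, ← mul_neg, neg_sub]
      have hnum : 0 ≤ (Γ + δ L) / c N := div_nonneg (add_nonneg hΓ0 (hδ0 L)) hcN.le
      calc (Γ + δ L) / c N * (1 - Real.exp (-(c N) * (t - t₀)))
          ≤ (Γ + δ L) / c N * 1 :=
            mul_le_mul_of_nonneg_left (by linarith [hexp0]) hnum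
        _ = (Γ + δ L) / c N := mul_one _
    linarith
  -- pass to the limit `L → ∞`
  have hsum : ∀ u : ℝ, Summable fun j : ℕ =>
      ∑ i : Fin 4, (1 / 2 : ℝ) * X i (N + (j : ℤ)) u ^ 2 :=
    fun u => orthantBreak_summable hε hM (n + 1) u
  have hlim1 : Tendsto (fun L : ℕ => EL L t) atTop
      (𝓝 (∑' j : ℕ, ∑ i : Fin 4, (1 / 2 : ℝ) * X i (N + (j : ℤ)) t ^ 2)) :=
    (hsum t).tendsto_sum_tsum_nat
  have hlim2 : Tendsto (fun L : ℕ => EL L t₀ * Real.exp (-(c N) * (t - t₀)) + (Γ + δ L) / c N)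
      atTop (𝓝 ((∑' j : ℕ, ∑ i : Fin 4, (1 / 2 : ℝ) * X i (N + (j : ℤ)) t₀ ^ 2) *
        Real.exp (-(c N) * (t - t₀)) + (Γ + 0) / c N)) := by
    refine ((hsum t₀).tendsto_sum_tsum_nat.mul_const _).add ?_
    refine (tendsto_const_nhds.add ?_).div_const _
    have := (tendsto_pow_atTop_nhds_zero_of_lt_one (sq_nonneg q)
      (pow_lt_one₀ hq0 hq1 two_ne_zero)).const_mul (coeffAbs α * M ^ 3 * (q ^ 2) ^ n)
    simpa [hδ] using this
  have hmain := le_of_tendsto_of_tendsto' hlim1 hlim2 hEt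
  -- identify the constants
  have hΓc : (Γ + 0) / c N = 128 * (1 + ε₀) ^ ((n : ℝ) - 4) / ν ^ 2 * E ^ 2 := by
    rw [add_zero, hΓ]
    have hsc2 : sc ^ 2 = (1 + ε₀) ^ ((5 : ℝ) * n) := by
      rw [hsc, ← Real.rpow_natCast, ← Real.rpow_mul h0.le]
      congr 1
      push_cast
      ring
    have hcN2 : c N * c N = ν ^ 2 * (1 + ε₀) ^ ((4 : ℝ) * n + 4) := by
      simp only [hcdef]
      rw [hNreal, show ν * (1 + ε₀) ^ ((2 : ℝ) * ((n : ℝ) + 1)) * (ν * (1 + ε₀) ^ ((2 : ℝ) *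
        ((n : ℝ) + 1))) = ν ^ 2 * ((1 + ε₀) ^ ((2 : ℝ) * ((n : ℝ) + 1)) * (1 + ε₀) ^ ((2 : ℝ) *
        ((n : ℝ) + 1))) by ring, ← Real.rpow_add h0]
      congr 1
      congr 1
      ring
    have hpow : (1 + ε₀) ^ ((n : ℝ) - 4) = (1 + ε₀) ^ ((5 : ℝ) * n) / (1 + ε₀) ^ ((4 : ℝ) * n + 4) := by
      rw [← Real.rpow_sub h0]
      congr 1
      ring
    have hden : 0 < (1 + ε₀) ^ ((4 : ℝ) * n + 4) := Real.rpow_pos_of_pos h0 _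
    rw [div_div, hcN2, hsc2, hpow]
    field_simp
  have hexpc : Real.exp (-(c N) * (t - t₀)) =
      Real.exp (-(ν * (1 + ε₀) ^ ((2 : ℝ) * (n + 1))) * (t - t₀)) := by
    simp only [hcdef, hNreal]
  rw [hΓc, hexpc] at hmain
  simpa [hN] using hmain

/-! ## The per-hop ratchet below the viscous threshold -/

/-- **The crux's inequality below the viscous threshold.** For a cancelling table with inter-shell
constants of modulus `≤ 1` and a regular solution of the `ν`-viscous lattice on `[0,s]` issued from
a one-shell datum at shell `0`: if on `[0,t]` the tail energy `T_n` stays `≤ M_x` (`M_x > 0`, e.g.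
its running maximum) and `M_x` is below the VISCOUS THRESHOLD of shell `n`,
`128 (1+ε₀)^{n−4} ν^{−2} M_x ≤ (1+ε₀)^{−(1+η)}`, then `T_{n+1}(t) ≤ (1+ε₀)^{−(1+η)} M_x`
(the dissipative cap with `t₀ = 0`, `T_{n+1}(0) = 0`, `e_n ≤ T_n ≤ M_x`). This is the per-hop
ratchet of `OrthantHopWake` on the dissipation-dominated set of `(n,t)`; the crux itself (a
transient depth chosen before `ν`) is NOT proved. MODEL lattice only. [this file] -/
theorem orthantHop_ratchet_of_viscousThreshold {ε₀ ν s M η Mx : ℝ} (hε : 0 < ε₀) (hν : 0 < ν)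
    {α : Fin 4 → Fin 4 → Fin 4 → ℤ × ℤ × ℤ → ℝ} (hc : IsCancellingCoeff α)
    (hA : ∀ i₁ i₂ i₃ : Fin 4, |α i₁ i₂ i₃ (0, 0, 1)| ≤ 1)
    {X₀ : Fin 4 → ℝ} {X : Fin 4 → ℤ → ℝ → ℝ}
    (hinit : ∀ (i : Fin 4) (k : ℤ), X i k 0 = if k = 0 then X₀ i else 0)
    (hM : ∀ (t : ℝ) (i : Fin 4) (k : ℤ), (1 + (1 + ε₀) ^ ((10 : ℝ) * k)) * |X i k t| ≤ M)
    (hcont : ∀ (i : Fin 4) (k : ℤ), Continuous (X i k))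
    (hder : ∀ (i : Fin 4) (k : ℤ), ∀ t ∈ Icc (0 : ℝ) s, HasDerivWithinAt (X i k)
      (quadTerm ε₀ α X i k t - ν * (1 + ε₀) ^ ((2 : ℝ) * k) * X i k t) (Icc (0 : ℝ) s) t)
    (n : ℕ) {t : ℝ} (ht : t ∈ Icc (0 : ℝ) s) (hMxpos : 0 < Mx)
    (hMx : ∀ u ∈ Icc (0 : ℝ) t,
      (∑' j : ℕ, ∑ i : Fin 4, (1 / 2 : ℝ) * X i ((n : ℕ) + (j : ℤ)) u ^ 2) ≤ Mx)
    (hthr : 128 * (1 + ε₀) ^ ((n : ℝ) - 4) / ν ^ 2 * Mx ≤ (1 + ε₀) ^ (-(1 + η))) :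
    (∑' j : ℕ, ∑ i : Fin 4, (1 / 2 : ℝ) * X i ((n + 1 : ℕ) + (j : ℤ)) t ^ 2) ≤
      (1 + ε₀) ^ (-(1 + η)) * Mx := by
  -- `e_n ≤ T_n ≤ Mx` on `[0,t]`
  have hEmax : ∀ u ∈ Icc (0 : ℝ) t, ∑ i : Fin 4, (1 / 2 : ℝ) * X i (n : ℤ) u ^ 2 ≤ Mx := by
    intro u hu
    have hs := orthantBreak_summable hε hM n u
    have h0 := hs.le_tsum 0 (fun j _ => Finset.sum_nonneg fun i _ => by positivity)
    simp only [Nat.cast_zero, add_zero] at h0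
    exact h0.trans (hMx u hu)
  have hcap := orthantHop_tail_dissipativeCap hε hν hc hA hM hcont hder n le_rfl ht.1 ht.2
    hMxpos hEmax
  -- the tail above shell `n+1 ≥ 1` is empty at time `0`
  have hz : ∀ j : ℕ, ∑ i : Fin 4, (1 / 2 : ℝ) * X i ((n + 1 : ℕ) + (j : ℤ)) 0 ^ 2 = 0 :=
    fun j => Finset.sum_eq_zero fun i _ => by
      rw [hinit, if_neg (by push_cast; omega)]
      ring
  simp only [hz, tsum_zero, zero_mul, zero_add] at hcap
  calc (∑' j : ℕ, ∑ i : Fin 4, (1 / 2 : ℝ) * X i ((n + 1 : ℕ) + (j : ℤ)) t ^ 2)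
      ≤ 128 * (1 + ε₀) ^ ((n : ℝ) - 4) / ν ^ 2 * Mx ^ 2 := hcap
    _ = (128 * (1 + ε₀) ^ ((n : ℝ) - 4) / ν ^ 2 * Mx) * Mx := by ring
    _ ≤ (1 + ε₀) ^ (-(1 + η)) * Mx := mul_le_mul_of_nonneg_right hthr hMxpos.le

/-- **The literal hop of the route decl below the viscous threshold.** Same setting as
`orthantHop_ratchet_of_viscousThreshold`, with `M_x` a value of `T_n` ATTAINED on `[0,t]` that
dominates `T_n` there (its running maximum): then there is `u ∈ [0,t]` with
`T_{n+1}(t) ≤ (1+ε₀)^{−(1+η)} T_n(u)` — the conclusion of `OrthantHopWake` at this `(n,t)`.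
MODEL lattice only; the crux (depth uniform in `ν`) is NOT proved. [this file] -/
theorem orthantHop_hop_of_viscousThreshold {ε₀ ν s M η Mx : ℝ} (hε : 0 < ε₀) (hν : 0 < ν)
    {α : Fin 4 → Fin 4 → Fin 4 → ℤ × ℤ × ℤ → ℝ} (hc : IsCancellingCoeff α)
    (hA : ∀ i₁ i₂ i₃ : Fin 4, |α i₁ i₂ i₃ (0, 0, 1)| ≤ 1)
    {X₀ : Fin 4 → ℝ} {X : Fin 4 → ℤ → ℝ → ℝ}
    (hinit : ∀ (i : Fin 4) (k : ℤ), X i k 0 = if k = 0 then X₀ i else 0)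
    (hM : ∀ (t : ℝ) (i : Fin 4) (k : ℤ), (1 + (1 + ε₀) ^ ((10 : ℝ) * k)) * |X i k t| ≤ M)
    (hcont : ∀ (i : Fin 4) (k : ℤ), Continuous (X i k))
    (hder : ∀ (i : Fin 4) (k : ℤ), ∀ t ∈ Icc (0 : ℝ) s, HasDerivWithinAt (X i k)
      (quadTerm ε₀ α X i k t - ν * (1 + ε₀) ^ ((2 : ℝ) * k) * X i k t) (Icc (0 : ℝ) s) t)
    (n : ℕ) {t : ℝ} (ht : t ∈ Icc (0 : ℝ) s) (hMxpos : 0 < Mx)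
    (hMx : ∀ u ∈ Icc (0 : ℝ) t,
      (∑' j : ℕ, ∑ i : Fin 4, (1 / 2 : ℝ) * X i ((n : ℕ) + (j : ℤ)) u ^ 2) ≤ Mx)
    (hattain : ∃ u ∈ Icc (0 : ℝ) t,
      (∑' j : ℕ, ∑ i : Fin 4, (1 / 2 : ℝ) * X i ((n : ℕ) + (j : ℤ)) u ^ 2) = Mx)
    (hthr : 128 * (1 + ε₀) ^ ((n : ℝ) - 4) / ν ^ 2 * Mx ≤ (1 + ε₀) ^ (-(1 + η))) :
    ∃ u ∈ Icc (0 : ℝ) t,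
      (∑' j : ℕ, ∑ i : Fin 4, (1 / 2 : ℝ) * X i ((n + 1 : ℕ) + (j : ℤ)) t ^ 2) ≤
        (1 + ε₀) ^ (-(1 + η)) *
          (∑' j : ℕ, ∑ i : Fin 4, (1 / 2 : ℝ) * X i ((n : ℕ) + (j : ℤ)) u ^ 2) := by
  obtain ⟨u, hu, huM⟩ := hattain
  refine ⟨u, hu, ?_⟩
  rw [huM]
  exact orthantHop_ratchet_of_viscousThreshold hε hν hc hA hinit hM hcont hder n ht hMxpos hMx hthr

end Summit.NavierStokesRegularity.NavierStokesRegularity.Theorems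

end
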